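import Mathlib

/-!
# Stub C3 `stub_circuitSumIdentity` — line `sml-polarised-transport`

Crux `FeketeSOS.SOSMagnification` (stmt-ValiantsHypothesis-3995), V-half (the digit lift is in VNP).

The sign-projected circuit-sum of any Boolean function `Φ(x, b)` on the one-hot wires
`x_{(j,i)} = [d_j = i]` plus one sign wire `b` that

* rejects every non-one-hot `x`, and
* accepts `(enc d, b)` iff `m(d) = Σ_j d_j k^j < p` and `(m(d) | p) = (b ? -1 : +1)`,

IS the one-hot base-`k` digit lift `Σ_{m<p} (m|p) · Π_{j<n} X_{(j, digit_j m)}` of the Fekete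
polynomial (`digit_j m = m / k^j % k`).  Pure `Finset`/`Fintype` reindexing in
`MvPolynomial (Fin n × Fin k) ℂ` along Mathlib's `finFunctionFinEquiv`.
-/

set_option linter.dupNamespace false

namespace Summit.ValiantsHypothesis.ValiantsHypothesis.Theorems.FeketeSOSSOSMagnification

open MvPolynomial

/-- The one-hot encoding `d ↦ (v ↦ [d v.1 = v.2])` of digit vectors is injective. -/
theorem circuitSum_oneHot_injective (n k : ℕ) :
    Function.Injective
      (fun (d : Fin n → Fin k) (v : Fin n × Fin k) => decide (d v.1 = v.2)) := by
  intro d d' h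
  funext j
  simpa using congrFun h (j, d' j)

/-- The monomial read off a one-hot point: `∏_v (if x_v then X_v else 1) = ∏_j X_{(j, d j)}`. -/
theorem circuitSum_prod_oneHot (n k : ℕ) (d : Fin n → Fin k) :
    (∏ v : Fin n × Fin k,
        (if decide (d v.1 = v.2) then (X v : MvPolynomial (Fin n × Fin k) ℂ) else 1)) =
      ∏ j : Fin n, X (j, d j) := by
  rw [Fintype.prod_prod_type]
  refine Fintype.prod_congr _ _ (fun j => ?_)
  simp only [decide_eq_true_eq]
  exact Fintype.prod_ite_eq (d j) (fun i => X (j, i))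

/-- The sign-projected `b`-sum at a one-hot point with the Legendre specification:
`Σ_b [φ b] · P · (b ? -1 : 1) = [q] · C (legendreSym p a) · P` when
`φ b ↔ q ∧ legendreSym p a = (b ? -1 : 1)` (trichotomy `legendreSym p a ∈ {0, 1, -1}`). -/
theorem circuitSum_boolSum_spec {σ : Type*} {p : ℕ} [Fact p.Prime] {a : ℤ} {q : Prop}
    [Decidable q] (φ : Bool → Bool) (P : MvPolynomial σ ℂ)
    (hφ : ∀ b, φ b = true ↔ (q ∧ legendreSym p a = if b then -1 else 1)) :
    (∑ b : Bool, (if φ b then (1 : MvPolynomial σ ℂ) else 0) *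
        (P * (if b then (-1 : MvPolynomial σ ℂ) else 1))) =
      if q then C ((legendreSym p a : ℤ) : ℂ) * P else 0 := by
  rw [Fintype.sum_bool]
  by_cases hq : q
  · rw [if_pos hq]
    by_cases ha : (a : ZMod p) = 0
    · have h0 : legendreSym p a = 0 := (legendreSym.eq_zero_iff p a).mpr ha
      have ht : ¬ (φ true = true) := by rw [hφ, h0]; simp
      have hf : ¬ (φ false = true) := by rw [hφ, h0]; simp
      rw [if_neg ht, if_neg hf, h0]
      simp
    · rcases legendreSym.eq_one_or_neg_one p ha with h1 | h1
      · have ht : ¬ (φ true = true) := by rw [hφ, h1]; simp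
        have hf : φ false = true := by rw [hφ, h1]; exact ⟨hq, by simp⟩
        rw [if_neg ht, if_pos hf, h1]
        simp
      · have ht : φ true = true := by rw [hφ, h1]; exact ⟨hq, by simp⟩
        have hf : ¬ (φ false = true) := by rw [hφ, h1]; simp
        rw [if_pos ht, if_neg hf, h1]
        simp
  · have ht : ¬ (φ true = true) := by rw [hφ]; exact fun h => hq h.1
    have hf : ¬ (φ false = true) := by rw [hφ]; exact fun h => hq h.1
    rw [if_neg ht, if_neg hf, if_neg hq]
    simp

/-- Reindexing digit vectors `d : Fin n → Fin k` by their value `m(d) = Σ_j d_j k^j < k^n`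
(Mathlib `finFunctionFinEquiv`), then cutting the range down to `m < p ≤ k^n`. -/
theorem circuitSum_reindex (k : ℕ) [NeZero k] (n p : ℕ) (hp : p ≤ k ^ n)
    (c : ℕ → MvPolynomial (Fin n × Fin k) ℂ) :
    (∑ d : Fin n → Fin k,
        if (∑ j : Fin n, (d j : ℕ) * k ^ (j : ℕ)) < p then
          c (∑ j : Fin n, (d j : ℕ) * k ^ (j : ℕ)) * ∏ j : Fin n, X (j, d j) else 0) =
      ∑ m ∈ Finset.range p, c m *
        ∏ j : Fin n, X (j, (⟨m / k ^ (j : ℕ) % k, Nat.mod_lt _ (Nat.pos_of_neZero k)⟩ : Fin k)) := by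
  rw [← Equiv.sum_comp finFunctionFinEquiv.symm]
  have hval : ∀ m : Fin (k ^ n),
      (∑ j : Fin n, ((finFunctionFinEquiv.symm m j : Fin k) : ℕ) * k ^ (j : ℕ)) = (m : ℕ) := by
    intro m
    rw [← finFunctionFinEquiv_apply, Equiv.apply_symm_apply]
  have hdig : ∀ (m : Fin (k ^ n)) (j : Fin n), finFunctionFinEquiv.symm m j =
      (⟨(m : ℕ) / k ^ (j : ℕ) % k, Nat.mod_lt _ (Nat.pos_of_neZero k)⟩ : Fin k) := by
    intro m j
    exact Fin.ext (finFunctionFinEquiv_symm_apply_val m j)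
  simp_rw [hval, hdig]
  rw [Fin.sum_univ_eq_sum_range (fun m => if m < p then c m *
      ∏ j : Fin n, X (j, (⟨m / k ^ (j : ℕ) % k, Nat.mod_lt _ (Nat.pos_of_neZero k)⟩ : Fin k)) else 0)
    (k ^ n)]
  rw [← Finset.sum_filter]
  refine Finset.sum_congr ?_ (fun _ _ => rfl)
  ext m
  simp only [Finset.mem_filter, Finset.mem_range]
  omega

/-- **Stub C3** (`Stmt.circuitSumIdentity`): the signed, sign-projected circuit-sum of any Boolean
function with the one-hot Legendre specification is the one-hot base-`k` digit lift of the Fekete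
polynomial `Σ_{m<p} (m|p) Π_j X_{(j, m / k^j % k)}`. -/
theorem stub_circuitSumIdentity :
    ∀ (k : ℕ) [NeZero k] (n p : ℕ) [Fact p.Prime], p ≤ k ^ n →
      ∀ Φ : ((Fin n × Fin k) → Bool) → Bool → Bool,
        (∀ x b, Φ x b = true → ∃ d : Fin n → Fin k, x = fun v => decide (d v.1 = v.2)) →
        (∀ (d : Fin n → Fin k) (b : Bool), Φ (fun v => decide (d v.1 = v.2)) b = true ↔
            (∑ j : Fin n, (d j : ℕ) * k ^ (j : ℕ) < p ∧
              legendreSym p (∑ j : Fin n, (d j : ℕ) * k ^ (j : ℕ) : ℕ) = if b then -1 else 1)) →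
        (∑ x : (Fin n × Fin k) → Bool, ∑ b : Bool,
            (if Φ x b then (1 : MvPolynomial (Fin n × Fin k) ℂ) else 0) *
              ((∏ v : Fin n × Fin k, if x v then (X v : MvPolynomial (Fin n × Fin k) ℂ) else 1) *
                (if b then (-1 : MvPolynomial (Fin n × Fin k) ℂ) else 1))) =
          ∑ m ∈ Finset.range p, C ((legendreSym p m : ℤ) : ℂ) *
            ∏ j : Fin n, X (j, (⟨m / k ^ (j : ℕ) % k, Nat.mod_lt _ (Nat.pos_of_neZero k)⟩ : Fin k)) := by
  intro k _ n p _ hp Φ h1 h2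
  have hvan : ∀ x ∉ Set.range
      (fun (d : Fin n → Fin k) (v : Fin n × Fin k) => decide (d v.1 = v.2)),
      (∑ b : Bool, (if Φ x b then (1 : MvPolynomial (Fin n × Fin k) ℂ) else 0) *
        ((∏ v : Fin n × Fin k, if x v then (X v : MvPolynomial (Fin n × Fin k) ℂ) else 1) *
          (if b then (-1 : MvPolynomial (Fin n × Fin k) ℂ) else 1))) = 0 := by
    intro x hx
    refine Finset.sum_eq_zero (fun b _ => ?_)
    have hΦ : ¬ (Φ x b = true) := by
      intro hxb
      obtain ⟨d, hd⟩ := h1 x b hxb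
      exact hx ⟨d, hd.symm⟩
    rw [if_neg hΦ, zero_mul]
  rw [← Fintype.sum_of_injective _ (circuitSum_oneHot_injective n k)
    (fun d => ∑ b : Bool,
      (if Φ (fun v => decide (d v.1 = v.2)) b then (1 : MvPolynomial (Fin n × Fin k) ℂ) else 0) *
        ((∏ v : Fin n × Fin k, if decide (d v.1 = v.2) then
            (X v : MvPolynomial (Fin n × Fin k) ℂ) else 1) *
          (if b then (-1 : MvPolynomial (Fin n × Fin k) ℂ) else 1))) _ hvan (fun _ => rfl)]
  rw [← circuitSum_reindex k n p hp (fun m => C ((legendreSym p m : ℤ) : ℂ))]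
  refine Fintype.sum_congr _ _ (fun d => ?_)
  rw [circuitSum_prod_oneHot n k d]
  exact circuitSum_boolSum_spec (Φ (fun v => decide (d v.1 = v.2))) _ (h2 d)

end Summit.ValiantsHypothesis.ValiantsHypothesis.Theorems.FeketeSOSSOSMagnification
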